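import Mathlib.FieldTheory.Finite.GaloisField
import Literature.Computability.MetaComplexity.SparseProductUncertainty
import Literature.Computability.MetaComplexity.ParityModTestCosetDensity
import HarnessLib

/-!
# AffBells33 — the AFFINE-TEST PARITY-CLASS DICHOTOMY (Part II of planner qa-qnc0-p1 g33's `FibreDichotomyProof33.lean` = `CubeDichotomy33.lean`)

Cell qa-qnc0, route DWalkThree (crux stmt-QuantumAdvantage-22907; rung (NP₁)).  AUTHORED AND PROVED BY THE PLANNER SEAT qa-qnc0-p1 g33 (farm rc 0 /
0 sorry; memo ROUND-32 §2–§3); landed VERBATIM (one-line docstrings added) by qn-prover-3 g19, ask P-33a(2).  Part I (SPUL) is the tree's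
`Literature.Computability.MetaComplexity.ProductSpan.two_pow_le_two_pow_mul_suppCard'` (qn-lit g32, p686007) and is imported, not restated.
CONTENT: for `K` affine MOD₃ tests on `{0,1}^Z`, a constant `τ` and a parity `p`, over a field of characteristic `2` with `ω² + ω + 1 = 0`,
either `τ + #passed` is even on the whole parity class `H_p` or it is odd on `≥ 2^Z/(4((2K+1)(Z+1))²)` points of `H_p`
(`parityClass_dichotomy_of_omega`): the loss-times-class indicator is a `≤ (2K+1)(Z+1)`-sparse combination of `𝔽₄ˣ`-valued product functions
(`gFn_eq_sum`) and SPUL applies.  The `𝔽₄` instantiation `parityClass_dichotomy` is in `AffBells33FibreDichotomy`.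
WHAT THIS IS NOT: no crux closed; separation NOT moved.
-/

namespace Summit.QuantumAdvantage.AdviceFreeQNC0.AffBells33

open Finset
open Literature.Computability.MetaComplexity.ProductSpan
open Literature.Computability.MetaComplexity.ParityModTestDensity (prodFn_sq ite_coord_eq)

variable {F : Type*} [Field F] [DecidableEq F]

section CubeDichotomy

omit [DecidableEq F] in
/-- `ω³ = 1`. -/
theorem omega_pow_three [CharP F 2] {ω : F} (hω : ω ^ 2 + ω + 1 = 0) : ω ^ 3 = 1 := by
  have h2 : (2 : F) = 0 := CharTwo.two_eq_zero
  linear_combination (ω + 1) * hω - (ω ^ 2 + ω + 1) * h2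

omit [DecidableEq F] in
/-- `ω ≠ 0` for a primitive cube root of unity. -/
theorem omega_ne_zero' {ω : F} (hω : ω ^ 2 + ω + 1 = 0) : ω ≠ 0 := by
  intro h; rw [h] at hω; simp at hω

omit [DecidableEq F] in
/-- `ω ≠ 1` for a primitive cube root of unity (characteristic 2). -/
theorem omega_ne_one' [CharP F 2] {ω : F} (hω : ω ^ 2 + ω + 1 = 0) : ω ≠ 1 := by
  intro h
  subst h
  have h2 : (2 : F) = 0 := CharTwo.two_eq_zero
  have : (1 : F) = 0 := by linear_combination hω - h2
  exact one_ne_zero this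

omit [DecidableEq F] in
/-- In characteristic 2 a natural number casts to `1` or `0` according to its parity. -/
theorem natCast_eq_ite [CharP F 2] (n : ℕ) : (n : F) = if n % 2 = 1 then 1 else 0 := by
  have h2 : (2 : F) = 0 := CharTwo.two_eq_zero
  conv_lhs => rw [← Nat.div_add_mod n 2]
  push_cast
  rw [h2]
  split_ifs with h
  · rw [h]; simp
  · have h' : n % 2 = 0 := by omega
    rw [h']; simp

/-- The cube-root character `a ↦ ω^a` on `ZMod 3`. -/
def chi (ω : F) (a : ZMod 3) : F := ω ^ a.val

omit [DecidableEq F] in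
/-- `χ(0) = 1`. -/
theorem chi_zero (ω : F) : chi ω 0 = 1 := by simp [chi]

omit [DecidableEq F] in
/-- powers of `ω` reduce mod 3. -/
theorem pow_eq_pow_mod_three {ω : F} (h3 : ω ^ 3 = 1) (m : ℕ) : ω ^ m = ω ^ (m % 3) := by
  conv_lhs => rw [← Nat.div_add_mod m 3, pow_add, pow_mul, h3, one_pow, one_mul]

omit [DecidableEq F] in
/-- `χ` is additive-to-multiplicative. -/
theorem chi_add {ω : F} (h3 : ω ^ 3 = 1) (a b : ZMod 3) : chi ω (a + b) = chi ω a * chi ω b := by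
  unfold chi
  rw [ZMod.val_add, ← pow_eq_pow_mod_three h3, pow_add]

omit [DecidableEq F] in
/-- `χ` of a sum is the product of the `χ`'s. -/
theorem chi_sum {ω : F} (h3 : ω ^ 3 = 1) {ι : Type*} (s : Finset ι) (f : ι → ZMod 3) :
    chi ω (∑ i ∈ s, f i) = ∏ i ∈ s, chi ω (f i) := by
  classical
  refine Finset.induction_on s ?_ ?_
  · simp [chi_zero]
  · intro a s ha ih
    rw [sum_insert ha, prod_insert ha, chi_add h3, ih]

/-- The admissible entry set `S = {1, ω, ω²}`. -/
def cubeRoots (ω : F) : Finset F := {1, ω, ω ^ 2}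

/-- powers of `ω` are cube roots. -/
theorem pow_mem_cubeRoots {ω : F} (h3 : ω ^ 3 = 1) (m : ℕ) : ω ^ m ∈ cubeRoots ω := by
  rw [pow_eq_pow_mod_three h3]
  have hm : m % 3 = 0 ∨ m % 3 = 1 ∨ m % 3 = 2 := by omega
  unfold cubeRoots
  rcases hm with h | h | h <;> rw [h] <;> simp

/-- `0` is not a cube root of unity. -/
theorem zero_notMem_cubeRoots {ω : F} (hω : ω ^ 2 + ω + 1 = 0) : (0 : F) ∉ cubeRoots ω := by
  have h0 := omega_ne_zero' hω
  unfold cubeRoots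
  simp only [mem_insert, mem_singleton, not_or]
  exact ⟨zero_ne_one, fun h => h0 h.symm, fun h => pow_ne_zero 2 h0 h.symm⟩

/-- there are at most three cube roots. -/
theorem card_cubeRoots_le (ω : F) : (cubeRoots ω).card ≤ 3 := by
  unfold cubeRoots
  exact Finset.card_le_three

omit [DecidableEq F] in
/-- The indicator identity `[a = 0] = 1 + ω^a + ω^{2a}` (char 2). -/
theorem ite_eq_zero_eq_chi [CharP F 2] {ω : F} (hω : ω ^ 2 + ω + 1 = 0) (a : ZMod 3) :
    (if a = 0 then (1 : F) else 0) = 1 + chi ω a + chi ω a ^ 2 := by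
  have h2 : (2 : F) = 0 := CharTwo.two_eq_zero
  have h3 := omega_pow_three hω
  unfold chi
  have hv := ZMod.val_lt a
  rcases (show a.val = 0 ∨ a.val = 1 ∨ a.val = 2 by omega) with h | h | h
  · rw [if_pos ((ZMod.val_eq_zero a).1 h), h, pow_zero, one_pow]
    linear_combination -h2
  · have ha : a ≠ 0 := fun h0 => by rw [(ZMod.val_eq_zero a).2 h0] at h; exact absurd h (by norm_num)
    rw [if_neg ha, h, pow_one]
    linear_combination -hω
  · have ha : a ≠ 0 := fun h0 => by rw [(ZMod.val_eq_zero a).2 h0] at h; exact absurd h (by norm_num)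
    rw [if_neg ha, h]
    have h4 : (ω ^ 2) ^ 2 = ω := by
      calc (ω ^ 2) ^ 2 = ω ^ 3 * ω := by ring
        _ = ω := by rw [h3, one_mul]
    rw [h4]
    linear_combination -hω

omit [DecidableEq F] in
/-- `[a = r] = 1 + χ(a − r) + χ(a − r)²`. -/
theorem ite_eq_eq_chi [CharP F 2] {ω : F} (hω : ω ^ 2 + ω + 1 = 0) (a r : ZMod 3) :
    (if a = r then (1 : F) else 0) = 1 + chi ω (a - r) + chi ω (a - r) ^ 2 := by
  rw [← ite_eq_zero_eq_chi hω (a - r)]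
  simp only [sub_eq_zero]

omit [DecidableEq F] in
/-- The character of an affine form is a scaled product function. -/
theorem chi_form {ω : F} (h3 : ω ^ 3 = 1) {Z : ℕ} (Pb : Fin Z → ZMod 3) (rb : ZMod 3) (y : Fin Z → Bool) :
    chi ω ((∑ i, if y i then Pb i else 0) - rb) = chi ω (-rb) * prodFn (fun i => chi ω (Pb i)) y := by
  rw [sub_eq_add_neg, chi_add h3, chi_sum h3, mul_comm]
  congr 1
  unfold prodFn
  refine prod_congr rfl fun i _ => ?_
  split_ifs
  · rfl
  · exact chi_zero ω



/-! ### The data of the expansion -/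

variable {Z K : ℕ}

/-- `τ + #{b : ⟨P_b, y⟩ = r_b}`. -/
def testCount (P : Fin K → Fin Z → ZMod 3) (r : Fin K → ZMod 3) (τ : ℕ) (y : Fin Z → Bool) : ℕ :=
  τ + (univ.filter fun b => (∑ i, if y i then P b i else 0) = r b).card

/-- number of ones of `y`. -/
def onesCard (y : Fin Z → Bool) : ℕ := (univ.filter fun i => y i = true).card

/-- coefficients of the loss part, indexed by `Option (Fin K × Bool)`. -/
def a1 (ω : F) (r : Fin K → ZMod 3) (τ : ℕ) (K' : ℕ) : Option (Fin K × Bool) → F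
  | none => (τ : F) + K'
  | some (b, false) => chi ω (-r b)
  | some (b, true) => chi ω (-r b) ^ 2

/-- patterns of the loss part. -/
def w1 (ω : F) (P : Fin K → Fin Z → ZMod 3) : Option (Fin K × Bool) → Fin Z → F
  | none => fun _ => 1
  | some (b, false) => fun i => chi ω (P b i)
  | some (b, true) => fun i => chi ω (P b i) ^ 2

/-- coefficients of the parity-class indicator, indexed by `Option (Fin Z)`. -/
def a2 (ω : F) (p Z' : ℕ) : Option (Fin Z) → F
  | none => 1 + (p : F) + Z' * ω
  | some _ => ω

/-- patterns of the parity-class indicator. -/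
def w2 (ω : F) : Option (Fin Z) → Fin Z → F
  | none => fun _ => 1
  | some i => Function.update (fun _ => (1 : F)) i ω

omit [DecidableEq F] in
/-- the test count, cast to characteristic 2, as a sum of product functions. -/
theorem cast_testCount_eq_sum [CharP F 2] {ω : F} (hω : ω ^ 2 + ω + 1 = 0)
    (P : Fin K → Fin Z → ZMod 3) (r : Fin K → ZMod 3) (τ : ℕ) (y : Fin Z → Bool) :
    (testCount P r τ y : F) = ∑ o, a1 ω r τ K o * prodFn (w1 ω P o) y := by
  have h3 := omega_pow_three hω
  have hb : ∀ b : Fin K, (if (∑ i, if y i then P b i else 0) = r b then (1 : F) else 0) =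
      1 + (chi ω (-r b) * prodFn (fun i => chi ω (P b i)) y + chi ω (-r b) ^ 2 * prodFn (fun i => chi ω (P b i) ^ 2) y) := by
    intro b
    rw [ite_eq_eq_chi hω, chi_form h3, mul_pow, prodFn_sq, add_assoc]
  unfold testCount
  push_cast
  rw [Finset.natCast_card_filter]
  simp only [hb, sum_add_distrib, sum_const, card_univ, Fintype.card_fin, nsmul_eq_mul, mul_one,
    Fintype.sum_option, Fintype.sum_prod_type, Fintype.sum_bool, a1, w1, prodFn_one]
  ring

omit [DecidableEq F] in
/-- the parity-class indicator as a sum of product functions. -/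
theorem parityInd_eq_sum [CharP F 2] {ω : F} (hω : ω ^ 2 + ω + 1 = 0) (p : ℕ) (y : Fin Z → Bool) :
    (if onesCard y % 2 = p % 2 then (1 : F) else 0) = ∑ o, a2 ω p Z o * prodFn (w2 ω o) y := by
  have hind : (if onesCard y % 2 = p % 2 then (1 : F) else 0) = 1 + (p : F) + ∑ i, (if y i then (1 : F) else 0) := by
    have hsum : ∑ i, (if y i then (1 : F) else 0) = (onesCard y : F) := by
      unfold onesCard
      rw [Finset.natCast_card_filter]
    rw [hsum]
    have hcast : (1 : F) + (p : F) + (onesCard y : F) = ((1 + p + onesCard y : ℕ) : F) := by push_cast; ring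
    rw [hcast, natCast_eq_ite]
    by_cases h : onesCard y % 2 = p % 2
    · rw [if_pos h, if_pos (by omega)]
    · rw [if_neg h, if_neg (by omega)]
  rw [hind]
  simp_rw [ite_coord_eq hω]
  rw [sum_add_distrib, sum_const, card_univ, Fintype.card_fin, nsmul_eq_mul, Fintype.sum_option]
  simp only [a2, w2, prodFn_one, mul_one]
  ring

/-- all coefficients -/
def aCoef (ω : F) (r : Fin K → ZMod 3) (τ p : ℕ) (K' Z' : ℕ) : Option (Fin K × Bool) × Option (Fin Z) → F :=
  fun o => a1 ω r τ K' o.1 * a2 (Z := Z) ω p Z' o.2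

/-- all patterns -/
def wVec (ω : F) (P : Fin K → Fin Z → ZMod 3) : Option (Fin K × Bool) × Option (Fin Z) → Fin Z → F :=
  fun o i => w1 ω P o.1 i * w2 ω o.2 i

/-- the function `g = 1_{H_p} · (τ + #passed)` read in `F`. -/
def gFn (P : Fin K → Fin Z → ZMod 3) (r : Fin K → ZMod 3) (τ p : ℕ) (y : Fin Z → Bool) : F :=
  if onesCard y % 2 = p % 2 then (testCount P r τ y : F) else 0

omit [DecidableEq F] in
/-- the loss-times-class function `gFn` as a sparse sum of product functions. -/
theorem gFn_eq_sum [CharP F 2] {ω : F} (hω : ω ^ 2 + ω + 1 = 0)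
    (P : Fin K → Fin Z → ZMod 3) (r : Fin K → ZMod 3) (τ p : ℕ) (y : Fin Z → Bool) :
    gFn (F := F) P r τ p y = ∑ o, aCoef ω r τ p K Z o * prodFn (wVec ω P o) y := by
  have hmul : gFn (F := F) P r τ p y = (testCount P r τ y : F) * (if onesCard y % 2 = p % 2 then (1 : F) else 0) := by
    unfold gFn
    split_ifs <;> simp
  rw [hmul, cast_testCount_eq_sum hω, parityInd_eq_sum hω, Finset.sum_mul_sum, Fintype.sum_prod_type]
  refine sum_congr rfl fun o₁ _ => sum_congr rfl fun o₂ _ => ?_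
  unfold aCoef wVec
  rw [← prodFn_mul]
  ring

omit [DecidableEq F] in
/-- the weights `w1` are powers of `ω`. -/
theorem w1_pow {ω : F} (P : Fin K → Fin Z → ZMod 3) (o : Option (Fin K × Bool)) (i : Fin Z) : ∃ m : ℕ, w1 ω P o i = ω ^ m := by
  rcases o with _ | ⟨b, _ | _⟩
  · exact ⟨0, by simp [w1]⟩
  · exact ⟨(P b i).val, rfl⟩
  · exact ⟨(P b i).val * 2, by simp only [w1, chi]; rw [pow_mul]⟩

omit [DecidableEq F] in
/-- the weights `w2` are powers of `ω`. -/
theorem w2_pow {ω : F} (o : Option (Fin Z)) (i : Fin Z) : ∃ m : ℕ, w2 ω o i = ω ^ m := by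
  rcases o with _ | i'
  · exact ⟨0, by simp [w2]⟩
  · by_cases h : i = i'
    · subst h; exact ⟨1, by simp [w2]⟩
    · exact ⟨0, by simp [w2, Function.update_of_ne h]⟩

/-- all weights `wVec` are cube roots of unity. -/
theorem wVec_mem {ω : F} (h3 : ω ^ 3 = 1) (P : Fin K → Fin Z → ZMod 3) (o : Option (Fin K × Bool) × Option (Fin Z)) (i : Fin Z) :
    wVec ω P o i ∈ cubeRoots ω := by
  obtain ⟨m₁, h₁⟩ := w1_pow (ω := ω) P o.1 i
  obtain ⟨m₂, h₂⟩ := w2_pow (ω := ω) o.2 i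
  unfold wVec
  rw [h₁, h₂, ← pow_add]
  exact pow_mem_cubeRoots h3 _

/-- **AFFINE-TEST PARITY-CLASS DICHOTOMY** (over any char-2 field with a primitive cube root `ω`). -/
theorem parityClass_dichotomy_of_omega [CharP F 2] {ω : F} (hω : ω ^ 2 + ω + 1 = 0)
    (P : Fin K → Fin Z → ZMod 3) (r : Fin K → ZMod 3) (τ p : ℕ) :
    (∀ y : Fin Z → Bool, onesCard y % 2 = p % 2 → testCount P r τ y % 2 = 0) ∨
      2 ^ Z ≤ 4 * ((2 * K + 1) * (Z + 1)) ^ 2 *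
        (univ.filter fun y : Fin Z → Bool => onesCard y % 2 = p % 2 ∧ testCount P r τ y % 2 = 1).card := by
  by_cases hall : ∀ y : Fin Z → Bool, onesCard y % 2 = p % 2 → testCount P r τ y % 2 = 0
  · exact Or.inl hall
  right
  push Not at hall
  obtain ⟨y₀, hy₀, hodd⟩ := hall
  have h3 := omega_pow_three hω
  have hcast : ∀ n : ℕ, (n : F) ≠ 0 ↔ n % 2 = 1 := by
    intro n
    rw [Ne, CharP.cast_eq_zero_iff F 2 n]
    omega
  -- the support of g is the set of odd points of the parity class
  have hsupp : suppCard (gFn (F := F) P r τ p) =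
      (univ.filter fun y : Fin Z → Bool => onesCard y % 2 = p % 2 ∧ testCount P r τ y % 2 = 1).card := by
    unfold suppCard
    congr 1
    ext y
    simp only [mem_filter, mem_univ, true_and, gFn]
    split_ifs with h
    · rw [hcast]; exact ⟨fun h' => ⟨h, h'⟩, fun h' => h'.2⟩
    · simp [h]
  have hex : ∃ y, gFn (F := F) P r τ p y ≠ 0 := by
    refine ⟨y₀, ?_⟩
    unfold gFn
    rw [if_pos hy₀, hcast]
    omega
  -- sparsity budget
  set s : ℕ := (univ : Finset (Option (Fin K × Bool) × Option (Fin Z))).card with hs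
  have hscard : s = (2 * K + 1) * (Z + 1) := by
    rw [hs, card_univ]
    simp only [Fintype.card_prod, Fintype.card_option, Fintype.card_fin, Fintype.card_bool]
    ring
  set m : ℕ := Nat.log 2 s + 1 with hm
  have hslt : s < 2 ^ m := Nat.lt_pow_succ_log_self (by norm_num) s
  have hspos : s ≠ 0 := by rw [hscard]; positivity
  have hA : s * (3 - 1) ^ (2 * m) ≤ 3 ^ (2 * m) := by
    have h1 : s * (3 - 1) ^ (2 * m) ≤ 2 ^ m * 4 ^ m := by
      rw [show (3 - 1 : ℕ) = 2 by norm_num, pow_mul, show (2 ^ 2 : ℕ) = 4 by norm_num]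
      exact Nat.mul_le_mul_right _ hslt.le
    have h2 : 2 ^ m * 4 ^ m ≤ 3 ^ (2 * m) := by
      rw [← mul_pow, pow_mul, show (3 ^ 2 : ℕ) = 9 by norm_num]
      exact Nat.pow_le_pow_left (by norm_num) m
    exact h1.trans h2
  have hmain := two_pow_le_two_pow_mul_suppCard (cubeRoots ω) (zero_notMem_cubeRoots hω) (card_cubeRoots_le ω)
    Z (2 * m) univ (aCoef ω r τ p K Z) (wVec ω P) (gFn P r τ p)
    (fun o _ i => wVec_mem h3 P o i) hA (fun y => gFn_eq_sum hω P r τ p y) hex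
  -- 2^(2m) ≤ 4 s²
  have hpow : 2 ^ (2 * m) ≤ 4 * s ^ 2 := by
    have hl : 2 ^ Nat.log 2 s ≤ s := Nat.pow_log_le_self 2 hspos
    calc 2 ^ (2 * m) = 4 * (2 ^ Nat.log 2 s) ^ 2 := by rw [hm]; ring
      _ ≤ 4 * s ^ 2 := Nat.mul_le_mul_left _ (Nat.pow_le_pow_left hl 2)
  rw [hsupp] at hmain
  rw [← hscard]
  calc 2 ^ Z ≤ 2 ^ (2 * m) * _ := hmain
    _ ≤ 4 * s ^ 2 * _ := Nat.mul_le_mul_right _ hpow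

end CubeDichotomy

end Summit.QuantumAdvantage.AdviceFreeQNC0.AffBells33
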